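import Literature.NumberTheory.Automorphic.HyperspecialSphericalCharactersGeneralWeight
import HarnessLib

/-!
# Satake parameters over an arbitrary algebraically closed field: Cartier's Corollary 4.2 for `ℋ(U(σ, J₀), K₀; L)`,
# `L` algebraically closed of characteristic prime to `q` (Treumann–Venkatesh §7.2; Cartier 1979 §IV Cor. 4.2; Gross 1998)

Topic `NumberTheory/Automorphic`; namespace `Literature.NumberTheory.Automorphic.HermitianLattice[.UnramifiedLocalConjDatum]`
(lane `lit-hodgefound`, Track 2 foundations; seat `lit-hodgefound-p11`, generation 49, row g49-#5).  DEFINITIONS with bodies (the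
`R`-linear versions `weylAlgAutOver`, `weylActionOver`, `embLaurentOver`, `antisymmLiftChar` of the `ℂ`-linear `weylAlgAut`,
`weylAction`, `embLaurent`, `antisymmEvalChar` of g48-#9/#10 — consistency lemmas `weylAlgAutOver_complex`, `embLaurentOver_complex`,
`antisymmLiftChar_laurentMonomialHom` identify the `ℂ` cases) + theorems; no named fact, no instance, no notation.

## The mathematics

`G = U(σ, J₀^{(N)})` over a `ℤᵐ⁰`-valued field with datum `hd` (any `σ`: the unramified unitary groups `U_N` and, for `σ = id`,
the split orthogonal groups `O_N(J₀)`), `K₀` hyperspecial, `Λ⁻ ⊆ ℤ^N` the antisymmetric cocharacters, `W = C_{S_N}(rev)`.  Let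
`L` be a FIELD and `w : ℤ^N → Lˣ` a weight whose transforms `𝒮_w(T) ∈ L[ℤ^N]` (`T ∈ ℋ(G, K₀; L)`) all lie in `L[Λ⁻]^W` — for
`U_N` this is the weight `u^{-⟨ν,·⟩}` with `(u : L) = q_F ≠ 0` (`HyperspecialUnitarySatakeImage`), for `O_N(J₀)` the weight `u^{-Λ}`
with `u² = q ≠ 0` (`SplitOrthogonalSatakeWeylInvariance`); so `L` may be any field of characteristic prime to `q` (containing `√q`
in the orthogonal case), e.g. `𝔽̄_ℓ`, `ℓ ∤ q`.  By the criterion of g49-#3, `𝒮_w : ℋ(G, K₀; L) ⥲ L[Λ⁻]^W`.  For a character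
`χ : ℤ^N → Lˣ` put `λ_χ = ev_χ ∘ 𝒮_w : ℋ(G, K₀; L) → L`.  THEOREM:

* (existence, `L` ALGEBRAICALLY CLOSED) **every `L`-algebra homomorphism `ℋ(G, K₀; L) → L` is `λ_χ` for some `χ`;**
* (uniqueness, any field `L`) **`λ_{χ'} = λ_χ` iff `χ'|_{Λ⁻}` and `χ|_{Λ⁻}` are `W`-conjugate.**

Hence `Hom_{L-alg}(ℋ(G, K₀; L), L) ≅ Hom(Λ⁻, Lˣ)/W = Â(L)/W` — the SATAKE PARAMETER of an `L`-valued character of the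
spherical Hecke algebra (Treumann–Venkatesh §7.2 Thm. (i): «`ℋ(G_v, K_v)` [with coefficients in an algebraically closed field `k`
in which `q_v` is invertible] `≅` `W`-invariant regular functions on `Â_v`»; «there does not seem to be a reference with
coefficients in `k`»; Cartier Cor. 4.2 is the case `L = ℂ`, in the tree as `HyperspecialSphericalCharactersGeneralWeight`).  The
proofs are those of g48-#9/#10 with `ℂ` replaced by `L`: `L[Λ⁻]` is integral over `L[Λ⁻]^W` (a finite group of automorphisms),
characters of `L[Λ⁻]^W` extend to `L[Λ⁻]` when `L` is algebraically closed (`FixedPointSubalgebraCharacters`, stated for any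
algebraically closed field), characters of `L[Λ⁻]` are `ev_χ` for characters `χ` of `Λ⁻` (extended to `ℤ^N` along the Siegel
retraction), and `W` is transitive on the characters of `L[Λ⁻]` above a character of `L[Λ⁻]^W` ([BourbakiAC5to7] V §2 no. 2 Thm. 2).

## What is formalised

* §1 (any commutative `R`) `weylAlgAutOver R N`, `weylActionOver R N`, `weylActionOver_smul`, `embLaurentOver R N` (+ `_apply`,
  `coeff_embLaurentOver_coe`, `coeff_embLaurentOver_of_not_mem`, `embLaurentOver_mem_antisymmSupported`), `smul_eq_self_iff_coeff_over`,
  **`forall_smul_eq_self_iff_mem_unitarySatakeTarget_over`**; consistency `weylAlgAutOver_complex`, `embLaurentOver_complex`.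
* §2 (any commutative `R`) `antisymmLiftChar χ` (`ev_{χ|Λ⁻} : R[Λ⁻] → R`), `lift_embLaurentOver`, `antisymmLiftChar_single_one`,
  `antisymmLiftChar_inv_smul_single_one`, `antisymmLiftChar_laurentMonomialHom`.
* §3 (any σ, weight `w` with `hmem`) `exists_satakeTransform_eq_embLaurentOver_of_forall_mem`, `heckeEigencharacter_eq_antisymmLiftChar`,
  **`exists_eq_heckeEigencharacter_of_isAlgClosed`** (EXISTENCE), `heckeEigencharacter_eq_of_exists_perm_of_forall_mem_field` (⇐, any
  commutative `R`), **`exists_perm_of_heckeEigencharacter_eq_of_field`** (⇒, any field), **`heckeEigencharacter_eq_iff_exists_perm_of_field`**.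
* §4 instances: **`exists_eq_heckeEigencharacter_of_isAlgClosed_unitary`** / **`heckeEigencharacter_eq_iff_exists_perm_of_field_unitary`**
  (`σ ≠ id`, `(u : L) = q_F`, `u ∈ Lˣ`), **`exists_eq_heckeEigencharacter_of_isAlgClosed_orthogonal`** /
  **`heckeEigencharacter_eq_iff_exists_perm_of_field_orthogonal`** (`σ = id`, `u² = q`).

## References
* [TreumannVenkatesh2016] D. Treumann, A. Venkatesh, *Functoriality, Smith theory, and the Brauer homomorphism*, Ann. of Math. 183
  (2016), §7.1–§7.2, Thm. (i) and its proof.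
* [CartierCorvallis1979] P. Cartier, *Representations of 𝔭-adic groups: a survey*, PSPM 33.1 (1979), §IV Thm. 4.1, Cor. 4.2.
* [GrossSatake1998] B. H. Gross, *On the Satake isomorphism*, LMS Lecture Notes 254 (1998), Prop. 3.6, §6 Prop. 6.4.
* [BourbakiAC5to7] N. Bourbaki, *Algèbre commutative*, Ch. V §2 no. 2 Thm. 2; §1 no. 9 Prop. 22.
* [Satake1963] I. Satake, Publ. Math. IHÉS 18 (1963), §6, §§8–9.
-/

noncomputable section

open scoped Valued WithZero Matrix MatrixGroups Pointwise
open MonoidAlgebra Representation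

namespace Literature.NumberTheory.Automorphic.HermitianLattice

open Literature.NumberTheory.Automorphic Literature.NumberTheory.Automorphic.CartanUnique

variable {R : Type*} [CommRing R] {N : ℕ}

/-! ## §1 `W` acting on `R[Λ⁻]`, and `R[Λ⁻]^W` versus `unitarySatakeTarget R N` -/

section Weyl

variable (R N) in
/-- **`W` acting on `R[Λ⁻]` by `R`-algebra automorphisms** (`π ↦ (x^μ ↦ x^{μ ∘ π⁻¹})`); for `R = ℂ` this is g48-#9's `weylAlgAut`.
[cite: CartierCorvallis1979, §IV Cor. 4.2] [cite: TreumannVenkatesh2016, §7.2] -/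
def weylAlgAutOver : revCentralizer N →* (AddMonoidAlgebra R (antisymmLattice N) ≃ₐ[R] AddMonoidAlgebra R (antisymmLattice N)) where
  toFun π := AddMonoidAlgebra.domCongr R R (antisymmLatticeCongr π)
  map_one' := by
    refine AlgEquiv.ext fun f => AddMonoidAlgebra.ext (Finsupp.ext fun m => ?_)
    rw [AddMonoidAlgebra.coeff_domCongr, AlgEquiv.one_apply]
    rfl
  map_mul' π ρ := by
    refine AlgEquiv.ext fun f => AddMonoidAlgebra.ext (Finsupp.ext fun m => ?_)
    rw [AddMonoidAlgebra.coeff_domCongr, AlgEquiv.mul_apply, AddMonoidAlgebra.coeff_domCongr, AddMonoidAlgebra.coeff_domCongr]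
    rfl

/-- The `ℂ`-linear case is the tree's `weylAlgAut`. [cite: CartierCorvallis1979, §IV Cor. 4.2] -/
theorem weylAlgAutOver_complex : weylAlgAutOver ℂ N = weylAlgAut N := rfl

variable (R N) in
/-- The `W`-action on `R[Λ⁻]` as a `MulSemiringAction` (a definition, used through `letI`). [cite: CartierCorvallis1979, §IV Cor. 4.2] -/
@[reducible] def weylActionOver : MulSemiringAction (revCentralizer N) (AddMonoidAlgebra R (antisymmLattice N)) :=
  MulSemiringAction.compHom _ (weylAlgAutOver R N)

/-- Under `weylActionOver`, `π • f = domCongr (π ·) f`. [cite: CartierCorvallis1979, §IV Cor. 4.2] -/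
theorem weylActionOver_smul (π : revCentralizer N) (f : AddMonoidAlgebra R (antisymmLattice N)) :
    (letI := weylActionOver R N; π • f) = AddMonoidAlgebra.domCongr R R (antisymmLatticeCongr π) f := rfl

variable (R N) in
/-- **`ι_* : R[Λ⁻] → R[ℤ^N]`**, the embedding of group algebras along `Λ⁻ ⊆ ℤ^N`; for `R = ℂ` the tree's `embLaurent`.
[cite: CartierCorvallis1979, §IV.2] -/
def embLaurentOver : AddMonoidAlgebra R (antisymmLattice N) →ₐ[R] AddMonoidAlgebra R (Fin N → ℤ) :=
  AddMonoidAlgebra.mapDomainAlgHom R R (antisymmLattice N).subtype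

/-- The `ℂ`-linear case is the tree's `embLaurent`. [cite: CartierCorvallis1979, §IV.2] -/
theorem embLaurentOver_complex : embLaurentOver ℂ N = embLaurent N := rfl

/-- `ι_* b = mapDomain (↑) b`. [cite: CartierCorvallis1979, §IV.2] -/
theorem embLaurentOver_apply (b : AddMonoidAlgebra R (antisymmLattice N)) :
    embLaurentOver R N b = AddMonoidAlgebra.mapDomain (antisymmLattice N).subtype b := by
  rw [embLaurentOver, AddMonoidAlgebra.mapDomainAlgHom_apply]

/-- The coefficients of `ι_* b` on `Λ⁻`. [cite: CartierCorvallis1979, §IV.2] -/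
theorem coeff_embLaurentOver_coe (b : AddMonoidAlgebra R (antisymmLattice N)) (m : antisymmLattice N) :
    (embLaurentOver R N b).coeff (m : Fin N → ℤ) = b.coeff m := by
  rw [embLaurentOver_apply, AddMonoidAlgebra.mapDomain, AddMonoidAlgebra.coeff_ofCoeff]
  exact Finsupp.mapDomain_apply Subtype.val_injective _ _

/-- The coefficients of `ι_* b` vanish off `Λ⁻`. [cite: CartierCorvallis1979, §IV.2] -/
theorem coeff_embLaurentOver_of_not_mem (b : AddMonoidAlgebra R (antisymmLattice N)) {μ : Fin N → ℤ} (hμ : μ ∉ antisymmLattice N) :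
    (embLaurentOver R N b).coeff μ = 0 := by
  rw [embLaurentOver_apply, AddMonoidAlgebra.mapDomain, AddMonoidAlgebra.coeff_ofCoeff]
  exact Finsupp.mapDomain_notin_range _ _ fun ⟨ν, hν⟩ => hμ (by rw [← hν]; exact ν.2)

/-- `ι_* b ∈ R[Λ⁻] ⊆ R[ℤ^N]`. [cite: CartierCorvallis1979, §IV.2] -/
theorem embLaurentOver_mem_antisymmSupported (b : AddMonoidAlgebra R (antisymmLattice N)) : embLaurentOver R N b ∈ antisymmSupported R N :=
  (AlgHom.mem_range _).2 ⟨b, rfl⟩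

/-- **`π • b = b` iff the coefficients of `ι_* b` are `π`-invariant.** [cite: CartierCorvallis1979, §IV Cor. 4.2] -/
theorem smul_eq_self_iff_coeff_over (π : revCentralizer N) (b : AddMonoidAlgebra R (antisymmLattice N)) :
    (letI := weylActionOver R N; π • b) = b ↔
      ∀ μ : Fin N → ℤ, (embLaurentOver R N b).coeff (μ ∘ ⇑(π : Equiv.Perm (Fin N))) = (embLaurentOver R N b).coeff μ := by
  rw [weylActionOver_smul]
  constructor
  · intro h μ
    by_cases hμ : μ ∈ antisymmLattice N
    · have h1 := congrArg (fun f => f.coeff ⟨μ, hμ⟩) h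
      simp only [AddMonoidAlgebra.coeff_domCongr] at h1
      have e1 : (embLaurentOver R N b).coeff (μ ∘ ⇑(π : Equiv.Perm (Fin N))) = b.coeff ((antisymmLatticeCongr π).symm ⟨μ, hμ⟩) :=
        coeff_embLaurentOver_coe b ((antisymmLatticeCongr π).symm ⟨μ, hμ⟩)
      have e2 : (embLaurentOver R N b).coeff μ = b.coeff ⟨μ, hμ⟩ := coeff_embLaurentOver_coe b ⟨μ, hμ⟩
      rw [e1, e2]
      exact h1
    · have hμ' : μ ∘ ⇑(π : Equiv.Perm (Fin N)) ∉ antisymmLattice N := fun h' => hμ (by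
        have h2 := comp_mem_antisymmLattice h' (π⁻¹).2
        rwa [Function.comp_assoc, ← Equiv.Perm.coe_mul, Subgroup.coe_inv, mul_inv_cancel, Equiv.Perm.coe_one,
          Function.comp_id] at h2)
      rw [coeff_embLaurentOver_of_not_mem b hμ, coeff_embLaurentOver_of_not_mem b hμ']
  · intro h
    refine AddMonoidAlgebra.ext (Finsupp.ext fun m => ?_)
    rw [AddMonoidAlgebra.coeff_domCongr, ← coeff_embLaurentOver_coe, ← coeff_embLaurentOver_coe, coe_antisymmLatticeCongr_symm]
    exact h m

/-- **`R[Λ⁻]^W = ι_*⁻¹(R[Λ⁻]^W ⊆ R[ℤ^N])`**: `b` is fixed by `W` iff `ι_* b ∈ unitarySatakeTarget R N`. [cite: CartierCorvallis1979, §IV Cor. 4.2]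
[cite: TreumannVenkatesh2016, §7.2] -/
theorem forall_smul_eq_self_iff_mem_unitarySatakeTarget_over (b : AddMonoidAlgebra R (antisymmLattice N)) :
    (∀ π : revCentralizer N, (letI := weylActionOver R N; π • b) = b) ↔ embLaurentOver R N b ∈ unitarySatakeTarget R N := by
  rw [unitarySatakeTarget, Algebra.mem_inf, mem_weylInvariants_unitarySatakeWeylGroup_iff]
  constructor
  · intro h
    exact ⟨embLaurentOver_mem_antisymmSupported b, fun π hπ μ => (smul_eq_self_iff_coeff_over ⟨π, hπ⟩ b).1 (h ⟨π, hπ⟩) μ⟩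
  · rintro ⟨-, h⟩ π
    exact (smul_eq_self_iff_coeff_over π b).2 (h π.1 π.2)

end Weyl

/-! ## §2 The characters `ev_{χ|Λ⁻}` of `R[Λ⁻]` -/

section LiftChar

/-- **`ev_{χ|Λ⁻} : R[Λ⁻] → R`**, evaluation at the restriction to `Λ⁻` of a character `χ` of `ℤ^N`; for `χ = (β^·)` over `ℂ` this is
g48-#10's `antisymmEvalChar β`. [cite: CartierCorvallis1979, §IV Cor. 4.2] -/
def antisymmLiftChar (χ : Multiplicative (Fin N → ℤ) →* R) : AddMonoidAlgebra R (antisymmLattice N) →ₐ[R] R :=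
  AddMonoidAlgebra.lift R R (antisymmLattice N) (χ.comp (AddMonoidHom.toMultiplicative (antisymmLattice N).subtype))

/-- The `ℂ`-linear case with `χ = χ_β` is the tree's `antisymmEvalChar β`. [cite: CartierCorvallis1979, §IV Cor. 4.2] -/
theorem antisymmLiftChar_laurentMonomialHom (β : Fin N → ℂˣ) : antisymmLiftChar (laurentMonomialHom β) = antisymmEvalChar β := rfl

/-- `ev_χ(ι_* b) = ev_{χ|Λ⁻}(b)`. [cite: CartierCorvallis1979, §IV Cor. 4.2] -/
theorem lift_embLaurentOver (χ : Multiplicative (Fin N → ℤ) →* R) (b : AddMonoidAlgebra R (antisymmLattice N)) :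
    AddMonoidAlgebra.lift R R (Fin N → ℤ) χ (embLaurentOver R N b) = antisymmLiftChar χ b := by
  rw [embLaurentOver_apply, lift_mapDomain]
  rfl

/-- `ev_{χ|Λ⁻}(x^m) = χ(m)`. [cite: CartierCorvallis1979, §IV Cor. 4.2] -/
theorem antisymmLiftChar_single_one (χ : Multiplicative (Fin N → ℤ) →* R) (m : antisymmLattice N) :
    antisymmLiftChar χ (AddMonoidAlgebra.single m 1) = χ (Multiplicative.ofAdd (m : Fin N → ℤ)) := by
  rw [antisymmLiftChar, AddMonoidAlgebra.lift_single, one_smul]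
  rfl

/-- `ev_{χ|Λ⁻}(g⁻¹ • x^m) = χ(m ∘ g)`. [cite: CartierCorvallis1979, §IV Cor. 4.2] -/
theorem antisymmLiftChar_inv_smul_single_one (χ : Multiplicative (Fin N → ℤ) →* R) (g : revCentralizer N) (m : antisymmLattice N) :
    antisymmLiftChar χ (letI := weylActionOver R N; g⁻¹ • AddMonoidAlgebra.single m (1 : R)) =
      χ (Multiplicative.ofAdd ((m : Fin N → ℤ) ∘ ⇑(g : Equiv.Perm (Fin N)))) := by
  rw [weylActionOver_smul, AddMonoidAlgebra.domCongr_single, antisymmLiftChar_single_one, coe_antisymmLatticeCongr, Subgroup.coe_inv,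
    inv_inv]

end LiftChar

/-! ## §3 Cartier's Cor. 4.2 over a field `L` -/

section Field

variable {K : Type*} [Field K] [Valued K ℤᵐ⁰] {σ : K →+* K} {ϖ : K}

namespace UnramifiedLocalConjDatum

/-- **Every `W`-fixed `b ∈ R[Λ⁻]` is `ι_*⁻¹ 𝒮_w(T)` for some `T`** (surjectivity criterion, any commutative `R`).
[cite: CartierCorvallis1979, §IV Thm. 4.1] [cite: TreumannVenkatesh2016, §7.2] -/
theorem exists_satakeTransform_eq_embLaurentOver_of_forall_mem (hd : UnramifiedLocalConjDatum σ ϖ)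
    [IsHeckeTriple (⊤ : Submonoid (unitaryGroupOfForm σ ((StdForm.antidiagonal N).over K)))
      (unitaryInt σ ((StdForm.antidiagonal N).over K)) (unitaryInt σ ((StdForm.antidiagonal N).over K))]
    (w : Multiplicative (Fin N → ℤ) →* R)
    (hmem : ∀ T : heckeAlgebra R (unitaryGroupOfForm σ ((StdForm.antidiagonal N).over K)) (unitaryInt σ ((StdForm.antidiagonal N).over K)),
      (hd.isIwasawaExponent (N := N)).satakeTransform w T ∈ unitarySatakeTarget R N)
    {b : AddMonoidAlgebra R (antisymmLattice N)} (hb : ∀ π : revCentralizer N, (letI := weylActionOver R N; π • b) = b) :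
    ∃ T : heckeAlgebra R (unitaryGroupOfForm σ ((StdForm.antidiagonal N).over K)) (unitaryInt σ ((StdForm.antidiagonal N).over K)),
      (hd.isIwasawaExponent (N := N)).satakeTransform w T = embLaurentOver R N b :=
  hd.exists_isIwasawaExponent_satakeTransform_eq_of_forall_mem w hmem _ ((forall_smul_eq_self_iff_mem_unitarySatakeTarget_over b).1 hb)

/-- `λ_χ(T) = ev_{χ|Λ⁻}(b)` when `𝒮_w(T) = ι_* b`. [cite: CartierCorvallis1979, §IV Cor. 4.2] -/
theorem heckeEigencharacter_eq_antisymmLiftChar (hd : UnramifiedLocalConjDatum σ ϖ) (w χ : Multiplicative (Fin N → ℤ) →* R)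
    {T : heckeAlgebra R (unitaryGroupOfForm σ ((StdForm.antidiagonal N).over K)) (unitaryInt σ ((StdForm.antidiagonal N).over K))}
    {b : AddMonoidAlgebra R (antisymmLattice N)} (h : (hd.isIwasawaExponent (N := N)).satakeTransform w T = embLaurentOver R N b) :
    (hd.isIwasawaExponent (N := N)).heckeEigencharacter w χ T = antisymmLiftChar χ b := by
  rw [IsIwasawaExponent.heckeEigencharacter_apply, h, lift_embLaurentOver]

/-- **(⇐) `W`-conjugate torus characters give the same eigencharacter**, over any commutative `R`: if `χ'(μ) = χ(μ ∘ π)` on `Λ⁻`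
for some `π ∈ W` and the transforms are `W`-invariant, then `λ_{χ'} = λ_χ`. [cite: CartierCorvallis1979, §IV Cor. 4.2] -/
theorem heckeEigencharacter_eq_of_exists_perm_of_forall_mem_field (hd : UnramifiedLocalConjDatum σ ϖ)
    (w : Multiplicative (Fin N → ℤ) →* R)
    (hmem : ∀ T : heckeAlgebra R (unitaryGroupOfForm σ ((StdForm.antidiagonal N).over K)) (unitaryInt σ ((StdForm.antidiagonal N).over K)),
      (hd.isIwasawaExponent (N := N)).satakeTransform w T ∈ unitarySatakeTarget R N)
    {χ χ' : Multiplicative (Fin N → ℤ) →* R} {π : Equiv.Perm (Fin N)} (hπ : ∀ i, π (Fin.rev i) = Fin.rev (π i))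
    (h : ∀ μ : Fin N → ℤ, (∀ i, μ (Fin.rev i) = -μ i) → χ' (Multiplicative.ofAdd μ) = χ (Multiplicative.ofAdd (μ ∘ ⇑π))) :
    (hd.isIwasawaExponent (N := N)).heckeEigencharacter w χ' = (hd.isIwasawaExponent (N := N)).heckeEigencharacter w χ := by
  letI := weylActionOver R N
  refine AlgHom.ext fun T => ?_
  have hST := hmem T
  obtain ⟨b, hb⟩ := (AlgHom.mem_range _).1 (((mem_unitarySatakeTarget_iff _).1 hST).1 |> (mem_antisymmSupported_iff _).2)
  have hb' : (hd.isIwasawaExponent (N := N)).satakeTransform w T = embLaurentOver R N b := hb.symm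
  have hfix : ∀ ρ : revCentralizer N, ρ • b = b :=
    (forall_smul_eq_self_iff_mem_unitarySatakeTarget_over b).2 (by rw [← hb']; exact hST)
  rw [hd.heckeEigencharacter_eq_antisymmLiftChar w χ' hb', hd.heckeEigencharacter_eq_antisymmLiftChar w χ hb']
  set g : revCentralizer N := ⟨π, hπ⟩ with hg
  have hchar : χ'.comp (AddMonoidHom.toMultiplicative (antisymmLattice N).subtype) =
      (χ.comp (AddMonoidHom.toMultiplicative (antisymmLattice N).subtype)).comp
        (AddMonoidHom.toMultiplicative (antisymmLatticeCongr g⁻¹).toAddMonoidHom) := by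
    refine MonoidHom.ext fun m => ?_
    show χ' (Multiplicative.ofAdd ((Multiplicative.toAdd m : antisymmLattice N) : Fin N → ℤ)) =
      χ (Multiplicative.ofAdd ((antisymmLatticeCongr g⁻¹ (Multiplicative.toAdd m) : antisymmLattice N) : Fin N → ℤ))
    rw [h _ (Multiplicative.toAdd m).2, coe_antisymmLatticeCongr, Subgroup.coe_inv, inv_inv]
  rw [antisymmLiftChar, antisymmLiftChar, hchar, lift_comp_toMultiplicative_eq_lift_domCongr]
  exact congrArg _ (hfix g⁻¹)

variable {L : Type*} [Field L]

/-- **SATAKE PARAMETERS OVER AN ALGEBRAICALLY CLOSED FIELD (Cartier Cor. 4.2, existence)**: `L` algebraically closed, `w` a weight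
with `W`-invariant transforms (so `char L ∤ q`); every `L`-algebra homomorphism `ψ : ℋ(U(σ, J₀^{(N)}), K₀; L) → L` is
`λ_χ = ev_χ ∘ 𝒮_w` for some character `χ : ℤ^N → Lˣ`. [cite: TreumannVenkatesh2016, §7.2 Thm. (i)] [cite: CartierCorvallis1979, §IV Cor. 4.2]
[cite: BourbakiAC5to7, Ch. V §1 no. 9 Prop. 22] -/
theorem exists_eq_heckeEigencharacter_of_isAlgClosed [IsAlgClosed L] (hd : UnramifiedLocalConjDatum σ ϖ)
    [IsHeckeTriple (⊤ : Submonoid (unitaryGroupOfForm σ ((StdForm.antidiagonal N).over K)))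
      (unitaryInt σ ((StdForm.antidiagonal N).over K)) (unitaryInt σ ((StdForm.antidiagonal N).over K))]
    (w : Multiplicative (Fin N → ℤ) →* L)
    (hmem : ∀ T : heckeAlgebra L (unitaryGroupOfForm σ ((StdForm.antidiagonal N).over K)) (unitaryInt σ ((StdForm.antidiagonal N).over K)),
      (hd.isIwasawaExponent (N := N)).satakeTransform w T ∈ unitarySatakeTarget L N)
    (ψ : heckeAlgebra L (unitaryGroupOfForm σ ((StdForm.antidiagonal N).over K)) (unitaryInt σ ((StdForm.antidiagonal N).over K)) →ₐ[L] L) :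
    ∃ χ : Multiplicative (Fin N → ℤ) →* L, ψ = (hd.isIwasawaExponent (N := N)).heckeEigencharacter w χ := by
  classical
  letI := weylActionOver L N
  -- the subalgebra `A = ι_*⁻¹(L[Λ⁻]^W)` of `B = L[Λ⁻]` contains the `W`-fixed points
  set A : Subalgebra L (AddMonoidAlgebra L (antisymmLattice N)) := (unitarySatakeTarget L N).comap (embLaurentOver L N) with hAdef
  have hA : ∀ b : AddMonoidAlgebra L (antisymmLattice N), (∀ g : revCentralizer N, g • b = b) → b ∈ A := fun b hb =>
    (Subalgebra.mem_comap _ _ _).2 ((forall_smul_eq_self_iff_mem_unitarySatakeTarget_over b).1 hb)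
  -- the character `φ = ψ ∘ 𝒮_w⁻¹ ∘ ι_*` of `A`
  set toTarget : A →ₐ[L] unitarySatakeTarget L N :=
    ((embLaurentOver L N).comp A.val).codRestrict (unitarySatakeTarget L N) fun a => (Subalgebra.mem_comap _ _ _).1 a.2 with htoTarget
  set φ : A →ₐ[L] L := (ψ.comp (hd.satakeAlgEquivOfForallMem (N := N) w hmem).symm.toAlgHom).comp toTarget with hφ
  -- extend `φ` to `Ψ : L[Λ⁻] → L`, a character `χ₀` of `Λ⁻`, extended to `χ` on `ℤ^N` along the Siegel retraction
  obtain ⟨Ψ, hΨ⟩ := exists_algHom_extend_of_fixedPoints A hA φ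
  set χ₀ : Multiplicative (antisymmLattice N) →* L := (AddMonoidAlgebra.lift L L (antisymmLattice N)).symm Ψ with hχ₀
  have hΨχ : Ψ = AddMonoidAlgebra.lift L L (antisymmLattice N) χ₀ := by rw [hχ₀, Equiv.apply_symm_apply]
  set χ : Multiplicative (Fin N → ℤ) →* L := χ₀.comp (AddMonoidHom.toMultiplicative (siegelRetract N)) with hχ
  have hχχ₀ : χ.comp (AddMonoidHom.toMultiplicative (antisymmLattice N).subtype) = χ₀ := by
    refine MonoidHom.ext fun m => ?_
    show χ₀ (Multiplicative.ofAdd (siegelRetract N ((antisymmLattice N).subtype (Multiplicative.toAdd m)))) = χ₀ m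
    rw [AddSubgroup.coe_subtype, siegelRetract_coe]
    rfl
  refine ⟨χ, AlgHom.ext fun T => ?_⟩
  -- unwind: `ψ T = φ(b_T) = Ψ(b_T) = χ(𝒮_w T)`
  have hST := hmem T
  obtain ⟨bT, hbT⟩ := (AlgHom.mem_range _).1 (((mem_unitarySatakeTarget_iff _).1 hST).1 |> (mem_antisymmSupported_iff _).2)
  have hbT' : embLaurentOver L N bT = (hd.isIwasawaExponent (N := N)).satakeTransform w T := hbT
  have hbA : bT ∈ A := (Subalgebra.mem_comap _ _ _).2 (by rw [hbT']; exact hST)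
  have h1 : ψ T = φ ⟨bT, hbA⟩ := by
    show ψ T = ψ ((hd.satakeAlgEquivOfForallMem (N := N) w hmem).symm (toTarget ⟨bT, hbA⟩))
    congr 1
    refine ((AlgEquiv.symm_apply_eq _).2 (Subtype.ext ?_)).symm
    rw [coe_satakeAlgEquivOfForallMem, htoTarget, AlgHom.coe_codRestrict, AlgHom.comp_apply, Subalgebra.coe_val]
    exact hbT'
  rw [h1, ← hΨ ⟨bT, hbA⟩, IsIwasawaExponent.heckeEigencharacter_apply, ← hbT', embLaurentOver_apply, lift_mapDomain, hχχ₀, hΨχ]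

/-- **(⇒) Equal eigencharacters have `W`-conjugate torus characters**, over any FIELD `L`: if `λ_{χ'} = λ_χ` then
`χ'(μ) = χ(μ ∘ π)` on `Λ⁻` for some `π ∈ W` (transitivity of `W` on the characters of `L[Λ⁻]` above a character of `L[Λ⁻]^W`).
[cite: TreumannVenkatesh2016, §7.2] [cite: CartierCorvallis1979, §IV Cor. 4.2] [cite: BourbakiAC5to7, Ch. V §2 no. 2 Thm. 2] -/
theorem exists_perm_of_heckeEigencharacter_eq_of_field (hd : UnramifiedLocalConjDatum σ ϖ)
    [IsHeckeTriple (⊤ : Submonoid (unitaryGroupOfForm σ ((StdForm.antidiagonal N).over K)))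
      (unitaryInt σ ((StdForm.antidiagonal N).over K)) (unitaryInt σ ((StdForm.antidiagonal N).over K))]
    (w : Multiplicative (Fin N → ℤ) →* L)
    (hmem : ∀ T : heckeAlgebra L (unitaryGroupOfForm σ ((StdForm.antidiagonal N).over K)) (unitaryInt σ ((StdForm.antidiagonal N).over K)),
      (hd.isIwasawaExponent (N := N)).satakeTransform w T ∈ unitarySatakeTarget L N)
    {χ χ' : Multiplicative (Fin N → ℤ) →* L}
    (h : (hd.isIwasawaExponent (N := N)).heckeEigencharacter w χ' = (hd.isIwasawaExponent (N := N)).heckeEigencharacter w χ) :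
    ∃ π : Equiv.Perm (Fin N), (∀ i, π (Fin.rev i) = Fin.rev (π i)) ∧
      ∀ μ : Fin N → ℤ, (∀ i, μ (Fin.rev i) = -μ i) → χ' (Multiplicative.ofAdd μ) = χ (Multiplicative.ofAdd (μ ∘ ⇑π)) := by
  classical
  letI := weylActionOver L N
  -- `A = L[Λ⁻]^W ⊆ B = L[Λ⁻]`
  set A : Subalgebra L (AddMonoidAlgebra L (antisymmLattice N)) := (unitarySatakeTarget L N).comap (embLaurentOver L N) with hAdef
  have hAfix : ∀ b : AddMonoidAlgebra L (antisymmLattice N), b ∈ A ↔ ∀ g : revCentralizer N, g • b = b := fun b =>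
    (Subalgebra.mem_comap _ _ _).trans (forall_smul_eq_self_iff_mem_unitarySatakeTarget_over b).symm
  haveI : Algebra.IsInvariant A (AddMonoidAlgebra L (antisymmLattice N)) (revCentralizer N) :=
    ⟨fun b hb => ⟨⟨b, (hAfix b).2 hb⟩, rfl⟩⟩
  haveI : SMulCommClass (revCentralizer N) A (AddMonoidAlgebra L (antisymmLattice N)) :=
    ⟨fun g a b => by
      rw [Algebra.smul_def, Algebra.smul_def, smul_mul']
      show g • (a : AddMonoidAlgebra L (antisymmLattice N)) * g • b = (a : AddMonoidAlgebra L (antisymmLattice N)) * g • b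
      rw [(hAfix a.1).1 a.2 g]⟩
  -- the two characters agree on `A`, so their kernels lie over the same maximal ideal of `A`
  have hagree : ∀ a : A, antisymmLiftChar χ' (a : AddMonoidAlgebra L (antisymmLattice N)) = antisymmLiftChar χ a := fun a => by
    obtain ⟨T, hT⟩ := hd.exists_satakeTransform_eq_embLaurentOver_of_forall_mem w hmem ((hAfix a.1).1 a.2)
    rw [← hd.heckeEigencharacter_eq_antisymmLiftChar w χ' hT, ← hd.heckeEigencharacter_eq_antisymmLiftChar w χ hT, h]
  have hsurj : ∀ γ : Multiplicative (Fin N → ℤ) →* L, Function.Surjective (antisymmLiftChar (N := N) γ) := fun γ c =>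
    ⟨algebraMap L _ c, AlgHom.commutes _ c⟩
  haveI hM : (RingHom.ker (antisymmLiftChar (N := N) χ)).IsMaximal := RingHom.ker_isMaximal_of_surjective _ (hsurj χ)
  haveI hM' : (RingHom.ker (antisymmLiftChar (N := N) χ')).IsMaximal := RingHom.ker_isMaximal_of_surjective _ (hsurj χ')
  have hunder : (RingHom.ker (antisymmLiftChar (N := N) χ)).under A = (RingHom.ker (antisymmLiftChar (N := N) χ')).under A := by
    refine Ideal.ext fun a => ?_
    change a ∈ (RingHom.ker (antisymmLiftChar (N := N) χ)).comap (algebraMap A _) ↔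
      a ∈ (RingHom.ker (antisymmLiftChar (N := N) χ')).comap (algebraMap A _)
    rw [Ideal.mem_comap, Ideal.mem_comap, RingHom.mem_ker, RingHom.mem_ker]
    show antisymmLiftChar χ (a : AddMonoidAlgebra L (antisymmLattice N)) = 0 ↔ antisymmLiftChar χ' (a : AddMonoidAlgebra L (antisymmLattice N)) = 0
    rw [hagree]
  obtain ⟨g, hg⟩ := Algebra.IsInvariant.exists_smul_of_under_eq (A := A) (B := AddMonoidAlgebra L (antisymmLattice N))
    (G := revCentralizer N) (P := RingHom.ker (antisymmLiftChar (N := N) χ)) (Q := RingHom.ker (antisymmLiftChar (N := N) χ')) hunder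
  -- `ev_{χ'} = ev_χ ∘ (g⁻¹ • ·)`: both are characters with the same kernel
  set Φ : AddMonoidAlgebra L (antisymmLattice N) →ₐ[L] L :=
    (antisymmLiftChar (N := N) χ).comp (weylAlgAutOver L N g⁻¹ : _ ≃ₐ[L] _).toAlgHom with hΦ
  have hΦapply : ∀ b, Φ b = antisymmLiftChar χ (g⁻¹ • b) := fun b => rfl
  have hker : RingHom.ker Φ ≤ RingHom.ker (antisymmLiftChar (N := N) χ') := fun b hb => by
    rw [RingHom.mem_ker] at hb ⊢
    have h1 : g⁻¹ • b ∈ RingHom.ker (antisymmLiftChar (N := N) χ) := by rw [RingHom.mem_ker]; exact hb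
    have h2 : b ∈ g • RingHom.ker (antisymmLiftChar (N := N) χ) := Ideal.mem_pointwise_smul_iff_inv_smul_mem.2 h1
    rw [← hg, RingHom.mem_ker] at h2
    exact h2
  have heq : antisymmLiftChar (N := N) χ' = Φ := algHom_eq_of_ker_le Φ (antisymmLiftChar χ') hker
  refine ⟨(g : Equiv.Perm (Fin N)), g.2, fun μ hμ => ?_⟩
  have h1 : antisymmLiftChar χ' (AddMonoidAlgebra.single ⟨μ, hμ⟩ 1) = Φ (AddMonoidAlgebra.single ⟨μ, hμ⟩ 1) := by rw [heq]
  rw [hΦapply, antisymmLiftChar_inv_smul_single_one, antisymmLiftChar_single_one] at h1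
  exact h1

/-- **SATAKE PARAMETERS OVER A FIELD, UNIQUENESS UP TO `W`**: over any field `L`, for a weight with `W`-invariant transforms,
`λ_{χ'} = λ_χ` iff `χ'|_{Λ⁻}` and `χ|_{Λ⁻}` are `W`-conjugate; with the existence over algebraically closed `L`:
`Hom_{L-alg}(ℋ(U(σ, J₀^{(N)}), K₀; L), L) ≅ Hom(Λ⁻, Lˣ)/W`. [cite: TreumannVenkatesh2016, §7.2 Thm. (i)] [cite: CartierCorvallis1979, §IV Cor. 4.2] -/
theorem heckeEigencharacter_eq_iff_exists_perm_of_field (hd : UnramifiedLocalConjDatum σ ϖ)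
    [IsHeckeTriple (⊤ : Submonoid (unitaryGroupOfForm σ ((StdForm.antidiagonal N).over K)))
      (unitaryInt σ ((StdForm.antidiagonal N).over K)) (unitaryInt σ ((StdForm.antidiagonal N).over K))]
    (w : Multiplicative (Fin N → ℤ) →* L)
    (hmem : ∀ T : heckeAlgebra L (unitaryGroupOfForm σ ((StdForm.antidiagonal N).over K)) (unitaryInt σ ((StdForm.antidiagonal N).over K)),
      (hd.isIwasawaExponent (N := N)).satakeTransform w T ∈ unitarySatakeTarget L N)
    (χ χ' : Multiplicative (Fin N → ℤ) →* L) :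
    (hd.isIwasawaExponent (N := N)).heckeEigencharacter w χ' = (hd.isIwasawaExponent (N := N)).heckeEigencharacter w χ ↔
      ∃ π : Equiv.Perm (Fin N), (∀ i, π (Fin.rev i) = Fin.rev (π i)) ∧
        ∀ μ : Fin N → ℤ, (∀ i, μ (Fin.rev i) = -μ i) → χ' (Multiplicative.ofAdd μ) = χ (Multiplicative.ofAdd (μ ∘ ⇑π)) :=
  ⟨hd.exists_perm_of_heckeEigencharacter_eq_of_field w hmem,
    fun ⟨_, hπ, h⟩ => hd.heckeEigencharacter_eq_of_exists_perm_of_forall_mem_field w hmem hπ h⟩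

end UnramifiedLocalConjDatum

end Field

/-! ## §4 The unramified unitary groups (`char L ∤ q`, `q_F ∈ Lˣ`) and the split orthogonal groups (`u² = q` in `L`) -/

section Instances

variable {K : Type*} [Field K] [Valued K ℤᵐ⁰] {σ : K →+* K} {ϖ : K} {L : Type*} [Field L]

namespace UnramifiedLocalConjDatum

/-- **SATAKE PARAMETERS OF `U_N` OVER AN ALGEBRAICALLY CLOSED FIELD OF CHARACTERISTIC PRIME TO `q`** (existence): `σ ≠ id`,
finite residue field, `u ∈ Lˣ` with `(u : L) = q_F`, `w = u^{-⟨ν,·⟩}`; every `ψ : ℋ(U(σ, J₀^{(N)}), K₀; L) →ₐ[L] L` is `λ_χ`.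
[cite: TreumannVenkatesh2016, §7.2 Thm. (i)] [cite: CartierCorvallis1979, §IV Cor. 4.2] [cite: Minguez2011, §4] -/
theorem exists_eq_heckeEigencharacter_of_isAlgClosed_unitary [IsAlgClosed L] (hd : UnramifiedLocalConjDatum σ ϖ) [Finite 𝓀[K]]
    (hσ : ∃ x : K, σ x ≠ x) (u : Lˣ) (hu : (u : L) = Nat.sqrt (Nat.card 𝓀[K])) (w : Multiplicative (Fin N → ℤ) →* L)
    (hw : ∀ e : Fin N → ℤ, w (Multiplicative.ofAdd e) = ((u ^ (-satakeTwistExp e) : Lˣ) : L))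
    [IsHeckeTriple (⊤ : Submonoid (unitaryGroupOfForm σ ((StdForm.antidiagonal N).over K)))
      (unitaryInt σ ((StdForm.antidiagonal N).over K)) (unitaryInt σ ((StdForm.antidiagonal N).over K))]
    (ψ : heckeAlgebra L (unitaryGroupOfForm σ ((StdForm.antidiagonal N).over K)) (unitaryInt σ ((StdForm.antidiagonal N).over K)) →ₐ[L] L) :
    ∃ χ : Multiplicative (Fin N → ℤ) →* L, ψ = (hd.isIwasawaExponent (N := N)).heckeEigencharacter w χ :=
  hd.exists_eq_heckeEigencharacter_of_isAlgClosed w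
    (fun T => hd.isIwasawaExponent_satakeTransform_mem_unitarySatakeTarget hσ u hu w hw T) ψ

/-- **Satake parameters of `U_N` over a field of characteristic prime to `q`, uniqueness up to `W`.**
[cite: TreumannVenkatesh2016, §7.2 Thm. (i)] [cite: CartierCorvallis1979, §IV Cor. 4.2] [cite: Minguez2011, §4] -/
theorem heckeEigencharacter_eq_iff_exists_perm_of_field_unitary (hd : UnramifiedLocalConjDatum σ ϖ) [Finite 𝓀[K]]
    (hσ : ∃ x : K, σ x ≠ x) (u : Lˣ) (hu : (u : L) = Nat.sqrt (Nat.card 𝓀[K])) (w : Multiplicative (Fin N → ℤ) →* L)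
    (hw : ∀ e : Fin N → ℤ, w (Multiplicative.ofAdd e) = ((u ^ (-satakeTwistExp e) : Lˣ) : L))
    [IsHeckeTriple (⊤ : Submonoid (unitaryGroupOfForm σ ((StdForm.antidiagonal N).over K)))
      (unitaryInt σ ((StdForm.antidiagonal N).over K)) (unitaryInt σ ((StdForm.antidiagonal N).over K))]
    (χ χ' : Multiplicative (Fin N → ℤ) →* L) :
    (hd.isIwasawaExponent (N := N)).heckeEigencharacter w χ' = (hd.isIwasawaExponent (N := N)).heckeEigencharacter w χ ↔
      ∃ π : Equiv.Perm (Fin N), (∀ i, π (Fin.rev i) = Fin.rev (π i)) ∧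
        ∀ μ : Fin N → ℤ, (∀ i, μ (Fin.rev i) = -μ i) → χ' (Multiplicative.ofAdd μ) = χ (Multiplicative.ofAdd (μ ∘ ⇑π)) :=
  hd.heckeEigencharacter_eq_iff_exists_perm_of_field w
    (fun T => hd.isIwasawaExponent_satakeTransform_mem_unitarySatakeTarget hσ u hu w hw T) χ χ'

/-- **SATAKE PARAMETERS OF THE SPLIT ORTHOGONAL GROUP `O_N(J₀)` OVER AN ALGEBRAICALLY CLOSED FIELD** (existence): `σ = id`, finite
residue field of `q` elements, `u ∈ Lˣ` with `u² = q`, `w = u^{-Λ}`; every `ψ : ℋ(O_N(J₀), K₀; L) →ₐ[L] L` is `λ_χ`.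
[cite: TreumannVenkatesh2016, §7.2 Thm. (i)] [cite: Satake1963, §6, §§8–9] -/
theorem exists_eq_heckeEigencharacter_of_isAlgClosed_orthogonal [IsAlgClosed L] (hd : UnramifiedLocalConjDatum (RingHom.id K) ϖ)
    [Finite 𝓀[K]] (u : Lˣ) (hu : (u : L) ^ 2 = Nat.card 𝓀[K]) (w : Multiplicative (Fin N → ℤ) →* L)
    (hw : ∀ e : Fin N → ℤ, w (Multiplicative.ofAdd e) =
      ((u ^ (-∑ p ∈ (Finset.univ : Finset (Fin N × Fin N)) with (p.1 < p.2 ∧ p.1 < Fin.rev p.2), (e p.1 - e p.2)) : Lˣ) : L))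
    [IsHeckeTriple (⊤ : Submonoid (unitaryGroupOfForm (RingHom.id K) ((StdForm.antidiagonal N).over K)))
      (unitaryInt (RingHom.id K) ((StdForm.antidiagonal N).over K)) (unitaryInt (RingHom.id K) ((StdForm.antidiagonal N).over K))]
    (ψ : heckeAlgebra L (unitaryGroupOfForm (RingHom.id K) ((StdForm.antidiagonal N).over K))
        (unitaryInt (RingHom.id K) ((StdForm.antidiagonal N).over K)) →ₐ[L] L) :
    ∃ χ : Multiplicative (Fin N → ℤ) →* L, ψ = (hd.isIwasawaExponent (N := N)).heckeEigencharacter w χ :=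
  hd.exists_eq_heckeEigencharacter_of_isAlgClosed w
    (fun T => hd.isIwasawaExponent_satakeTransform_mem_unitarySatakeTarget_orthogonal u hu w hw T) ψ

/-- **Satake parameters of `O_N(J₀)` over a field containing `√q`, uniqueness up to the signed permutation group `W`.**
[cite: TreumannVenkatesh2016, §7.2 Thm. (i)] [cite: Satake1963, §6, §§8–9] -/
theorem heckeEigencharacter_eq_iff_exists_perm_of_field_orthogonal (hd : UnramifiedLocalConjDatum (RingHom.id K) ϖ) [Finite 𝓀[K]]
    (u : Lˣ) (hu : (u : L) ^ 2 = Nat.card 𝓀[K]) (w : Multiplicative (Fin N → ℤ) →* L)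
    (hw : ∀ e : Fin N → ℤ, w (Multiplicative.ofAdd e) =
      ((u ^ (-∑ p ∈ (Finset.univ : Finset (Fin N × Fin N)) with (p.1 < p.2 ∧ p.1 < Fin.rev p.2), (e p.1 - e p.2)) : Lˣ) : L))
    [IsHeckeTriple (⊤ : Submonoid (unitaryGroupOfForm (RingHom.id K) ((StdForm.antidiagonal N).over K)))
      (unitaryInt (RingHom.id K) ((StdForm.antidiagonal N).over K)) (unitaryInt (RingHom.id K) ((StdForm.antidiagonal N).over K))]
    (χ χ' : Multiplicative (Fin N → ℤ) →* L) :
    (hd.isIwasawaExponent (N := N)).heckeEigencharacter w χ' = (hd.isIwasawaExponent (N := N)).heckeEigencharacter w χ ↔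
      ∃ π : Equiv.Perm (Fin N), (∀ i, π (Fin.rev i) = Fin.rev (π i)) ∧
        ∀ μ : Fin N → ℤ, (∀ i, μ (Fin.rev i) = -μ i) → χ' (Multiplicative.ofAdd μ) = χ (Multiplicative.ofAdd (μ ∘ ⇑π)) :=
  hd.heckeEigencharacter_eq_iff_exists_perm_of_field w
    (fun T => hd.isIwasawaExponent_satakeTransform_mem_unitarySatakeTarget_orthogonal u hu w hw T) χ χ'

end UnramifiedLocalConjDatum

end Instances

end Literature.NumberTheory.Automorphic.HermitianLattice

end
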